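/-
Copyright (c) 2026. All rights reserved.
Released under Apache 2.0 license as described in the file LICENSE.
-/
import Summits.Langlands.Langlands.Theorems.SoloInformedCrystallineCompatibleTrivial
import Summits.Langlands.Langlands.Theorems.SoloInformedRepairD2CrisGLOne
import Literature.NumberTheory.GaloisRepresentations.FramedRepTwist
import HarnessLib

/-!
# Tate-twist stability of the crystalline clause: `D_cris(ρ) ≃ D_cris(ρ ⊗ χ^k)` over the constructed `B_max`

Programme `solo-Langlands-informed`, repair D2-cris of `Summit.Langlands` (clause `D2Cris.CrystallineCompatibleAt`
of `Theorems/SoloInformedRepairD2Cris`, typed over the CONSTRUCTED `D2Cris.Bmax F p = A_max[1/t]`).  This file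
certifies, unconditionally and for EVERY `ρ`, that the clause is stable under Tate twists with the Frobenius
normalisation it was typed with.
* §1 (abstract).  A TWIST DATUM for `ρ, ρ' : Γ → GL_m(E)` on `E^m ⊗_{ℚ_p} B`: a `ℚ_p`-valued `c` with `ρ' = c · ρ` and
  `w ∈ B` with `c(σ) σ(w) = w`; then `T_w := 1 ⊗ (w·)` maps `D(ρ) = (E^m ⊗ B)^Γ` to `D(ρ')` (`twistMap`), is an
  isomorphism with inverse `T_{w'}` for an inverse datum with `w w' = 1` (`twistEquiv`), and `φ' T_w = λ · T_w φ` when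
  `φ w = λ w` (`phiD_twistMap`, `toMatrix_map_twistEquiv_pow`).
* §2 (polynomials).  `charpoly (c • M) = c^N · charpoly(M)(c⁻¹X)`, so `charpoly M = geomFrobPolyOfSatake ι α ^ f` gives
  `charpoly (c • M) = geomFrobPolyOfSatake ι (ι(c) · α) ^ f` (`charpoly_smul_eq_geomFrobPolyOfSatake_pow`).
* §3 (the Tate twist).  For a `p`-adic field `F` (instance context of `…RepairD2CrisGLOne`) and `χ^k = tateChar F p k`
  (`k : ℕ`) the datum is `c = χ^k, w = t^{-k}, w' = t^k, λ = p^{-k}` (`σ t = χ(σ) t`, `φ t = p t` in the tree's `B_max^+`):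
  ★ `DcrisTwistEquiv ρ k : D_cris(ρ) ≃ D_cris(ρ ⊗ χ^k)`; ★★ a basis of `D_cris(ρ)` with `charpoly (φ^f) =
  geomFrobPolyOfSatake ι α ^ f` yields one of `D_cris(ρ ⊗ χ^k)` with `charpoly (φ^f) = geomFrobPolyOfSatake ι (p^{-kf} · α) ^ f`
  (`exists_basis_charpoly_phiDcris_of_eq_twist`); twisting commutes with restriction to `Γ_{K_v}` (`toLocal_twist_tateChar`).
* §4 (the clause).  ★★★ `CrystallineCompatibleAt ι π ρ v hv → CrystallineCompatibleAt ι π' (ρ ⊗ χ_ℓ^k) v hv` whenever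
  `π'` has Satake parameter `q_v^{-k} · α_π` at `v`, `q_v = ℓ^{f(v|ℓ)}` (`crystallineCompatibleAt_twist_tateChar`); with
  rung Λ12: ★★ every Tate twist `χ_ℓ^k · 𝟙_n` satisfies the clause at every absolutely unramified `v ∣ ℓ` against
  `{q_v^{-k}, …, q_v^{-k}}` (`crystallineCompatibleAt_twist_one_tateChar_of_ramificationIdx_eq_one`).

NORMALISATION CHECK.  At `v ∤ ℓ` the summit pins the ARITHMETIC Frobenius to `∏ (X - (ι⁻¹ a)⁻¹)`: on `χ_ℓ^k`,
`q_v^k = (ι⁻¹ a)⁻¹`, i.e. `a = q_v^{-k}`.  At `v ∣ ℓ` the clause pins `charpoly (φ^{f(v|ℓ)}) = (∏ (X - ι⁻¹ a))^{f(v|ℓ)}`: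
by §3 the `φ^f`-eigenvalues on `D_cris(χ_ℓ^k)` are `p^{-kf} = q_v^{-k}`, i.e. again `a = q_v^{-k}` — the clause's GEOMETRIC
convention (`WD(D_cris)(Frob_geom) = φ^f`) asks for the SAME parameter above `ℓ` as the summit's arithmetic convention
away from `ℓ`, on every Tate twist of every pair (the full-rank, all-`k` form of the one-vector check of
`…RepairD2CrisGLOne`).  No admissibility, no `B_max^{Γ_F} = F₀`, no reciprocity datum is used.  Not treated: `k < 0`.
References: J.-M. Fontaine, Astérisque 223 (1994), Exp. II §2.3, Exp. III §1.5; K. Buzzard, T. Gee, LMS LNS 414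
(2014), §2.4, Conj. 3.2.1–3.2.2; J.-P. Serre, Abelian ℓ-adic representations (1968), Ch. I §1.2.
-/

noncomputable section

open scoped MatrixGroups TensorProduct ValuativeRel Polynomial NumberField Classical
open Field IsLocalRing ValuativeRel IsDedekindDomain Polynomial
open Literature.NumberTheory.GaloisRepresentations Literature.NumberTheory.PAdicHodge
open Literature.NumberTheory.GaloisRepresentations.IsNonarchimedeanLocalField
open Literature.NumberTheory.Automorphic

namespace Summit.Langlands.Langlands.Theorems

namespace D2Cris

open D2St

section Abstract

variable {p : ℕ} [Fact p.Prime] {E : Type*} [Field E] [Algebra ℚ_[p] E] {Γ : Type*} {B : Type*} [CommRing B]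
  [Algebra ℚ_[p] B] {m : ℕ} {ρ ρ' : Γ → GL (Fin m) E} {gal : Γ → (B →ₐ[ℚ_[p]] B)} {c c' : Γ → ℚ_[p]} {w w' : B}
  (hρ' : ∀ σ, ((ρ' σ : GL (Fin m) E) : Matrix (Fin m) (Fin m) E) = algebraMap ℚ_[p] E (c σ) • ((ρ σ : GL (Fin m) E) : Matrix _ _ E))
  (hw : ∀ σ, c σ • gal σ w = w)
  (hρ : ∀ σ, ((ρ σ : GL (Fin m) E) : Matrix (Fin m) (Fin m) E) = algebraMap ℚ_[p] E (c' σ) • ((ρ' σ : GL (Fin m) E) : Matrix _ _ E))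
  (hw' : ∀ σ, c' σ • gal σ w' = w') (hww' : w * w' = 1)

include hρ' hw in
/-- **Twist datum (`ρ' = c · ρ`, `c` valued in `ℚ_p`, `c(σ) σ(w) = w`) ⇒ `1 ⊗ (w·)` intertwines the diagonal actions**:
`(ρ'(σ) ⊗ σ) ∘ (1 ⊗ w) = (1 ⊗ w) ∘ (ρ(σ) ⊗ σ)` (the scalar crosses `⊗_{ℚ_p}`). [cite: FontaineAsterisque223III, Exp. III §1.5] -/
theorem diagAct_comp_endTensor_mulLeft_of_twist (σ : Γ) :
    diagAct ρ' gal σ ∘ₗ endTensor (E := E) (LinearMap.mulLeft ℚ_[p] w) =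
      endTensor (LinearMap.mulLeft ℚ_[p] w) ∘ₗ diagAct ρ gal σ := by
  refine TensorProduct.AlgebraTensorModule.ext fun v b => ?_
  simp only [LinearMap.comp_apply, endTensor_mulLeft_tmul, diagAct, TensorProduct.AlgebraTensorModule.map_tmul,
    AlgHom.toLinearMap_apply, map_mul]
  rw [hρ' σ, LinearEquiv.map_smul, LinearMap.smul_apply, algebraMap_smul, TensorProduct.smul_tmul,
    ← smul_mul_assoc, hw σ]

include hρ' hw in
/-- **The transport map `T_w := (1 ⊗ (w·))|_{D(ρ)} : D(ρ) → D(ρ')`** of a twist datum. [cite: FontaineAsterisque223III, Exp. III §1.5] -/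
def twistMap : invariants ρ gal →ₗ[E] invariants ρ' gal :=
  (endTensor (E := E) (LinearMap.mulLeft ℚ_[p] w)).restrict fun x (hx : ∀ σ, diagAct ρ gal σ x = x) (σ : Γ) =>
    show diagAct ρ' gal σ (endTensor (E := E) (LinearMap.mulLeft ℚ_[p] w) x) =
        endTensor (E := E) (LinearMap.mulLeft ℚ_[p] w) x by
      have h := LinearMap.congr_fun (diagAct_comp_endTensor_mulLeft_of_twist hρ' hw σ) x
      simp only [LinearMap.comp_apply] at h
      rw [h, hx σ]

/-- Underlying tensor of `T_w x`. [folklore] -/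
theorem coe_twistMap (x : invariants ρ gal) :
    ((twistMap hρ' hw x : invariants ρ' gal) : (Fin m → E) ⊗[ℚ_[p]] B) =
      endTensor (E := E) (LinearMap.mulLeft ℚ_[p] w) (x : (Fin m → E) ⊗[ℚ_[p]] B) := rfl

include hww' in
/-- `T_w ∘ T_{w'} = id` for a datum `(c, w) : ρ → ρ'`, a datum `(c', w') : ρ' → ρ` and `w w' = 1`. [folklore] -/
theorem twistMap_comp_twistMap : twistMap hρ' hw ∘ₗ twistMap hρ hw' = LinearMap.id := by
  refine LinearMap.ext fun x => Subtype.ext ?_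
  rw [LinearMap.comp_apply, coe_twistMap, coe_twistMap, ← LinearMap.comp_apply, ← endTensor_mulLeft_mul, hww',
    endTensor_mulLeft_one]
  rfl

include hρ' hw hρ hw' hww' in
/-- **`T_w : D(ρ) ≃ D(ρ')` with inverse `T_{w'}`** (twist datum, inverse datum, `w w' = 1`). [cite: FontaineAsterisque223III, Exp. III §1.5] -/
def twistEquiv : invariants ρ gal ≃ₗ[E] invariants ρ' gal :=
  LinearEquiv.ofLinear (twistMap hρ' hw) (twistMap hρ hw') (twistMap_comp_twistMap hρ' hw hρ hw' hww')
    (twistMap_comp_twistMap hρ hw' hρ' hw ((mul_comm w' w).trans hww'))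

/-- `twistEquiv` is `T_w`. [folklore] -/
theorem twistEquiv_apply (x : invariants ρ gal) : twistEquiv hρ' hw hρ hw' hww' x = twistMap hρ' hw x := rfl

/-- `(1 ⊗ φ) ∘ (1 ⊗ w) = λ · (1 ⊗ w) ∘ (1 ⊗ φ)` when `φ w = λ w` with `λ ∈ ℚ_p`. [folklore] -/
theorem phiTensor_comp_endTensor_mulLeft_of_smul {φ : B →ₐ[ℚ_[p]] B} {lam : ℚ_[p]} (hφw : φ w = lam • w) :
    phiTensor (E := E) (m := m) φ ∘ₗ endTensor (LinearMap.mulLeft ℚ_[p] w) =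
      algebraMap ℚ_[p] E lam • (endTensor (LinearMap.mulLeft ℚ_[p] w) ∘ₗ phiTensor φ) := by
  refine TensorProduct.AlgebraTensorModule.ext fun v b => ?_
  simp only [LinearMap.comp_apply, LinearMap.smul_apply, endTensor_mulLeft_tmul, phiTensor,
    TensorProduct.AlgebraTensorModule.map_tmul, LinearMap.id_apply, AlgHom.toLinearMap_apply, map_mul, hφw,
    smul_mul_assoc, TensorProduct.tmul_smul, algebraMap_smul]

/-- **`φ_{D(ρ')} (T_w x) = λ · T_w (φ_{D(ρ)} x)`** when `φ w = λ w`, `λ ∈ ℚ_p`. [cite: FontaineAsterisque223III, Exp. III §1.5] -/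
theorem phiD_twistMap {φ : B →ₐ[ℚ_[p]] B} (hφ : ∀ σ, (gal σ).comp φ = φ.comp (gal σ)) {lam : ℚ_[p]}
    (hφw : φ w = lam • w) (x : invariants ρ gal) :
    phiD ρ' gal φ hφ (twistMap hρ' hw x) = algebraMap ℚ_[p] E lam • twistMap hρ' hw (phiD ρ gal φ hφ x) := by
  apply Subtype.ext
  have h := LinearMap.congr_fun (phiTensor_comp_endTensor_mulLeft_of_smul (E := E) (m := m) hφw) (x : (Fin m → E) ⊗[ℚ_[p]] B)
  simpa only [LinearMap.comp_apply, LinearMap.smul_apply, coe_phiD, coe_twistMap, Submodule.coe_smul] using h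

/-- Powers: `φ_{D(ρ')}^f (T_w x) = λ^f · T_w (φ_{D(ρ)}^f x)`. [folklore] -/
theorem phiD_pow_twistMap {φ : B →ₐ[ℚ_[p]] B} (hφ : ∀ σ, (gal σ).comp φ = φ.comp (gal σ)) {lam : ℚ_[p]}
    (hφw : φ w = lam • w) (f : ℕ) (x : invariants ρ gal) :
    (phiD ρ' gal φ hφ ^ f) (twistMap hρ' hw x) = algebraMap ℚ_[p] E lam ^ f • twistMap hρ' hw ((phiD ρ gal φ hφ ^ f) x) := by
  induction f generalizing x with
  | zero => rw [pow_zero, pow_zero, pow_zero, Module.End.one_apply, Module.End.one_apply, one_smul]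
  | succ f ih =>
    rw [pow_succ (phiD ρ' gal φ hφ), pow_succ (phiD ρ gal φ hφ), Module.End.mul_apply, Module.End.mul_apply,
      phiD_twistMap hρ' hw hφ hφw, map_smul, ih, smul_smul, ← pow_succ']

/-- **Matrix form**: in the basis `T_w(b)` the matrix of `φ_{D(ρ')}^f` is `λ^f ·` the matrix of `φ_{D(ρ)}^f` in `b`. [folklore] -/
theorem toMatrix_map_twistEquiv_pow {φ : B →ₐ[ℚ_[p]] B} (hφ : ∀ σ, (gal σ).comp φ = φ.comp (gal σ))
    {lam : ℚ_[p]} (hφw : φ w = lam • w) {ι : Type*} [Fintype ι] [DecidableEq ι]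
    (b : Module.Basis ι E (invariants ρ gal)) (f : ℕ) :
    LinearMap.toMatrix (b.map (twistEquiv hρ' hw hρ hw' hww')) (b.map (twistEquiv hρ' hw hρ hw' hww'))
      (phiD ρ' gal φ hφ ^ f) = algebraMap ℚ_[p] E lam ^ f • LinearMap.toMatrix b b (phiD ρ gal φ hφ ^ f) := by
  ext i j
  rw [LinearMap.toMatrix_apply, Module.Basis.map_apply, Module.Basis.map_repr, LinearEquiv.trans_apply,
    twistEquiv_apply, phiD_pow_twistMap hρ' hw hφ hφw, map_smul, ← twistEquiv_apply hρ' hw hρ hw' hww',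
    LinearEquiv.symm_apply_apply, map_smul, Matrix.smul_apply, LinearMap.toMatrix_apply, Finsupp.smul_apply]

end Abstract

section Charpoly

variable {R : Type*} [Field R] {N : Type*} [Fintype N] [DecidableEq N]

/-- `charmatrix (c • M) = C c • (charmatrix M)(c⁻¹ X)` entrywise, `c ≠ 0`. [folklore] -/
theorem charmatrix_smul_of_ne_zero (c : R) (hc : c ≠ 0) (M : Matrix N N R) :
    Matrix.charmatrix (c • M) = C c • (Polynomial.compRingHom (C c⁻¹ * X)).mapMatrix (Matrix.charmatrix M) := by
  ext i j
  by_cases h : i = j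
  · subst h
    simp only [Matrix.charmatrix_apply_eq, Matrix.smul_apply, smul_eq_mul, RingHom.mapMatrix_apply,
      Matrix.map_apply, Polynomial.coe_compRingHom_apply, sub_comp, X_comp, C_comp]
    rw [mul_sub, ← mul_assoc, ← C_mul, mul_inv_cancel₀ hc, C_1, one_mul, C_mul]
  · simp only [Matrix.charmatrix_apply_ne _ _ _ h, Matrix.smul_apply, smul_eq_mul, RingHom.mapMatrix_apply,
      Matrix.map_apply, Polynomial.coe_compRingHom_apply, neg_comp, C_comp]
    rw [mul_neg, ← C_mul]

/-- **`charpoly (c • M) = c^N · (charpoly M)(c⁻¹ X)`** for an `N × N` matrix over a field, `c ≠ 0`. [folklore] -/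
theorem charpoly_smul_of_ne_zero (c : R) (hc : c ≠ 0) (M : Matrix N N R) :
    (c • M).charpoly = C (c ^ Fintype.card N) * M.charpoly.comp (C c⁻¹ * X) := by
  unfold Matrix.charpoly
  rw [charmatrix_smul_of_ne_zero c hc M, Matrix.det_smul, ← RingHom.map_det, Polynomial.coe_compRingHom_apply, C_pow]

/-- `c^{|α|} · (∏_{a ∈ α} (X - a))(c⁻¹ X) = ∏_{a ∈ α} (X - c a)`, `c ≠ 0`. [folklore] -/
theorem C_pow_card_mul_prod_X_sub_C_comp (α : Multiset R) (c : R) (hc : c ≠ 0) :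
    C (c ^ Multiset.card α) * ((α.map fun a => X - C a).prod).comp (C c⁻¹ * X) =
      (α.map fun a => X - C (c * a)).prod := by
  induction α using Multiset.induction_on with
  | empty => simp
  | cons a s ih =>
    have hlin : C c * (X - C a).comp (C c⁻¹ * X) = X - C (c * a) := by
      rw [sub_comp, X_comp, C_comp, mul_sub, ← mul_assoc, ← C_mul, mul_inv_cancel₀ hc, C_1, one_mul, C_mul]
    rw [Multiset.card_cons, Multiset.map_cons, Multiset.prod_cons, Multiset.map_cons, Multiset.prod_cons,
      mul_comp, pow_succ, C_mul, ← ih, ← hlin]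
    ring

variable {ℓ : ℕ} [Fact ℓ.Prime]

/-- `geomFrobPolyOfSatake ι α = ∏_{r ∈ ι⁻¹ α} (X - r)`. [folklore] -/
theorem geomFrobPolyOfSatake_eq_prod_map (ι : PadicAlgCl ℓ ≃+* ℂ) (α : Multiset ℂ) :
    geomFrobPolyOfSatake ι α = ((α.map ι.symm).map fun r => X - C r).prod := by
  unfold geomFrobPolyOfSatake; rw [Multiset.map_map]; rfl

/-- `deg (geomFrobPolyOfSatake ι α) = |α|`. [folklore] -/
theorem natDegree_geomFrobPolyOfSatake (ι : PadicAlgCl ℓ ≃+* ℂ) (α : Multiset ℂ) :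
    (geomFrobPolyOfSatake ι α).natDegree = Multiset.card α := by
  rw [geomFrobPolyOfSatake_eq_prod_map, Polynomial.natDegree_multiset_prod_X_sub_C_eq_card, Multiset.card_map]

/-- **Scaling the predicted polynomial**: `charpoly M = geomFrobPolyOfSatake ι α ^ f` and `c ≠ 0` give
`charpoly (c • M) = geomFrobPolyOfSatake ι (ι(c) · α) ^ f`. [folklore] -/
theorem charpoly_smul_eq_geomFrobPolyOfSatake_pow (ι : PadicAlgCl ℓ ≃+* ℂ) {M : Matrix N N (PadicAlgCl ℓ)}
    {α : Multiset ℂ} {f : ℕ} (hM : M.charpoly = geomFrobPolyOfSatake ι α ^ f) {c : PadicAlgCl ℓ} (hc : c ≠ 0) :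
    (c • M).charpoly = geomFrobPolyOfSatake ι (α.map fun a => ι c * a) ^ f := by
  have hcard : Fintype.card N = f * Multiset.card α := by
    have h := congrArg Polynomial.natDegree hM
    rwa [Matrix.charpoly_natDegree_eq_dim, Polynomial.natDegree_pow, natDegree_geomFrobPolyOfSatake] at h
  have key : C (c ^ Multiset.card α) * (geomFrobPolyOfSatake ι α).comp (C c⁻¹ * X) =
      geomFrobPolyOfSatake ι (α.map fun a => ι c * a) := by
    rw [geomFrobPolyOfSatake_eq_prod_map ι α, ← Multiset.card_map ι.symm α,
      C_pow_card_mul_prod_X_sub_C_comp _ c hc, geomFrobPolyOfSatake_eq_prod_map]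
    simp only [Multiset.map_map, Function.comp_def, map_mul, RingEquiv.symm_apply_apply]
  rw [charpoly_smul_of_ne_zero c hc M, hM, hcard, pow_mul', C_pow, pow_comp, ← mul_pow, key]

end Charpoly

section TateChar

variable (F : Type) [Field F] (p : ℕ) [Fact p.Prime]

/-- **`χ^k : Γ_F → ℚ̄_p^×`** (`k : ℕ`), the `k`-th power of the `p`-adic cyclotomic character as a continuous character
(`det` of the tree's framed `FramedGaloisRep.cyclotomicPadicAlgCl`, then `x ↦ x^k`). [cite: SerreAbelianLadic1968, Ch. I §1.2] -/
def tateChar (k : ℕ) : absoluteGaloisGroup F →ₜ* (PadicAlgCl p)ˣ :=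
  ContinuousMonoidHom.comp ⟨powMonoidHom k, continuous_pow k⟩ (FramedRep.det (FramedGaloisRep.cyclotomicPadicAlgCl F p))

variable {F p}

/-- `χ^k(σ) = χ(σ)^k`, a scalar from `ℚ_p`. [folklore] -/
theorem coe_tateChar (k : ℕ) (σ : absoluteGaloisGroup F) :
    ((tateChar F p k σ : (PadicAlgCl p)ˣ) : PadicAlgCl p) = algebraMap ℚ_[p] (PadicAlgCl p) (cycQp σ ^ k) := by
  show (((FramedRep.det (FramedGaloisRep.cyclotomicPadicAlgCl F p) σ) ^ k : (PadicAlgCl p)ˣ) : PadicAlgCl p) = _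
  rw [Units.val_pow_eq_pow_val, FramedRep.det_apply, Matrix.GeneralLinearGroup.val_det_apply, Matrix.det_fin_one,
    FramedGaloisRep.cyclotomicPadicAlgCl_apply_coe, map_pow]
  rfl

/-- `(ρ ⊗ χ^k)(σ) = χ(σ)^k · ρ(σ)` on matrices, the scalar from `ℚ_p`. [folklore] -/
theorem coe_twist_tateChar {m : ℕ} (ρ : FramedRep (absoluteGaloisGroup F) (PadicAlgCl p) m) (k : ℕ) (σ : absoluteGaloisGroup F) :
    ((FramedRep.twist ρ (tateChar F p k) σ : GL (Fin m) (PadicAlgCl p)) : Matrix (Fin m) (Fin m) (PadicAlgCl p)) =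
      algebraMap ℚ_[p] (PadicAlgCl p) (cycQp σ ^ k) • ((ρ σ : GL (Fin m) (PadicAlgCl p)) : Matrix (Fin m) (Fin m) (PadicAlgCl p)) := by
  rw [FramedRep.coe_twist_apply, coe_tateChar]

/-- Conversely `ρ(σ) = χ(σ)^{-k} · (ρ ⊗ χ^k)(σ)`. [folklore] -/
theorem coe_eq_smul_coe_twist_tateChar {m : ℕ} (ρ : FramedRep (absoluteGaloisGroup F) (PadicAlgCl p) m) (k : ℕ) (σ : absoluteGaloisGroup F) :
    ((ρ σ : GL (Fin m) (PadicAlgCl p)) : Matrix (Fin m) (Fin m) (PadicAlgCl p)) = algebraMap ℚ_[p] (PadicAlgCl p) ((cycQp σ)⁻¹ ^ k) •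
      ((FramedRep.twist ρ (tateChar F p k) σ : GL (Fin m) (PadicAlgCl p)) : Matrix (Fin m) (Fin m) (PadicAlgCl p)) := by
  rw [coe_twist_tateChar, smul_smul, ← map_mul, ← mul_pow, inv_mul_cancel₀ (cycQp_ne_zero σ), one_pow, map_one, one_smul]

/-- `χ_K^k (res σ) = χ_L^k (σ)` along the tree's restriction `absGaloisRestrict K L : Γ_L → Γ_K`. [folklore] -/
theorem tateChar_absGaloisRestrict (K L : Type) [Field K] [Field L] [Algebra K L] [NeZero ((p : ℕ) : K)] (k : ℕ)
    (σ : absoluteGaloisGroup L) : tateChar K p k (absGaloisRestrict K L σ) = tateChar L p k σ := by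
  apply Units.ext
  rw [coe_tateChar, coe_tateChar]; unfold cycQp; rw [cyclotomicCharacter_absGaloisRestrict]

/-- **Restriction to `Γ_{K_v}` commutes with Tate twists**: `(ρ ⊗ χ_K^k)|Γ_{K_v} = ρ|Γ_{K_v} ⊗ χ_{K_v}^k`. [folklore] -/
theorem toLocal_twist_tateChar {n : ℕ} {K : Type} [Field K] [NumberField K] (ρ : FramedGaloisRep K (PadicAlgCl p) n)
    (k : ℕ) (v : HeightOneSpectrum (𝓞 K)) :
    FramedGaloisRep.toLocal v (FramedRep.twist ρ (tateChar K p k)) =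
      FramedRep.twist (ρ.toLocal v) (tateChar (v.adicCompletion K) p k) := by
  haveI : NeZero ((p : ℕ) : K) := ⟨Nat.cast_ne_zero.2 (Fact.out : p.Prime).ne_zero⟩
  refine ContinuousMonoidHom.ext fun σ => ?_
  rw [FramedGaloisRep.toLocal_apply, FramedRep.twist_apply, FramedRep.twist_apply, FramedGaloisRep.toLocal_apply,
    tateChar_absGaloisRestrict]

end TateChar

section BmaxTwist

variable {F : Type} [Field F] [ValuativeRel F] [TopologicalSpace F] [IsNonarchimedeanLocalField F] [CharZero F]
  {p : ℕ} [Fact p.Prime] [Fact (¬ IsUnit (p : integerC F))] [IsAdicComplete (Ideal.span {(p : integerC F)}) (integerC F)] {m : ℕ}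

/-- `t^{-k} · t^k = 1` in `B_max(F)`. [folklore] -/
theorem tInv_pow_mul_algebraMap_tBmax_pow (k : ℕ) :
    (tInv : Bmax F p) ^ k * algebraMap (BmaxPlus F p) (Bmax F p) tBmax ^ k = 1 := by
  rw [← mul_pow, mul_comm, algebraMap_tBmax_mul_tInv, one_pow]

/-- `σ t = χ(σ) t` in `B_max(F)`. [cite: FontaineAsterisque223III, Exp. II §2.3] -/
theorem galBmax_algebraMap_tBmax (σ : absoluteGaloisGroup F) :
    galBmax (F := F) (p := p) σ (algebraMap (BmaxPlus F p) (Bmax F p) tBmax) =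
      algebraMap ℚ_[p] (Bmax F p) (cycQp σ) * algebraMap (BmaxPlus F p) (Bmax F p) tBmax := by
  rw [galBmax_algebraMap, galBmaxPlus_tBmax, map_mul, cycQp, ← zpToBmax_eq_algebraMap]
  rfl

/-- **`χ(σ)^k · σ(t^{-k}) = t^{-k}`**: `(χ^k, t^{-k})` is a twist datum `ρ → ρ ⊗ χ^k`. [cite: FontaineAsterisque223III, Exp. II §2.3] -/
theorem cycQp_pow_smul_galBmaxAlgHom_tInv_pow (σ : absoluteGaloisGroup F) (k : ℕ) :
    (cycQp (p := p) σ ^ k) • galBmaxAlgHom (F := F) (p := p) σ ((tInv : Bmax F p) ^ k) = (tInv : Bmax F p) ^ k := by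
  rw [show galBmaxAlgHom (F := F) (p := p) σ (tInv ^ k) = galBmax σ (tInv ^ k) from rfl, map_pow, galBmax_tInv,
    mul_pow, ← map_pow, Algebra.smul_def, ← mul_assoc, ← map_mul, ← mul_pow, mul_inv_cancel₀ (cycQp_ne_zero σ),
    one_pow, map_one, one_mul]

/-- **`χ(σ)^{-k} · σ(t^k) = t^k`**: `(χ^{-k}, t^k)` is the inverse datum `ρ ⊗ χ^k → ρ`. [cite: FontaineAsterisque223III, Exp. II §2.3] -/
theorem cycQp_inv_pow_smul_galBmaxAlgHom_tBmax_pow (σ : absoluteGaloisGroup F) (k : ℕ) :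
    ((cycQp (p := p) σ)⁻¹ ^ k) • galBmaxAlgHom (F := F) (p := p) σ (algebraMap (BmaxPlus F p) (Bmax F p) tBmax ^ k) =
      algebraMap (BmaxPlus F p) (Bmax F p) tBmax ^ k := by
  rw [show galBmaxAlgHom (F := F) (p := p) σ (algebraMap (BmaxPlus F p) (Bmax F p) tBmax ^ k) =
      galBmax σ (algebraMap (BmaxPlus F p) (Bmax F p) tBmax ^ k) from rfl, map_pow, galBmax_algebraMap_tBmax,
    mul_pow, ← map_pow, Algebra.smul_def, ← mul_assoc, ← map_mul, ← mul_pow, inv_mul_cancel₀ (cycQp_ne_zero σ),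
    one_pow, map_one, one_mul]

/-- **`φ(t^{-k}) = p^{-k} t^{-k}`**: the Frobenius datum. [cite: FontaineAsterisque223III, Exp. II §2.3] -/
theorem frobBmaxAlgHom_tInv_pow (k : ℕ) :
    frobBmaxAlgHom F p ((tInv : Bmax F p) ^ k) = ((p : ℚ_[p])⁻¹ ^ k) • (tInv : Bmax F p) ^ k := by
  rw [show frobBmaxAlgHom F p (tInv ^ k) = frobBmax F p (tInv ^ k) from rfl, map_pow, frobBmax_tInv, mul_pow,
    ← map_pow, ← Algebra.smul_def]

/-- ★ **`D_cris(ρ) ≃ D_cris(ρ ⊗ χ^k)`, `x ↦ (1 ⊗ t^{-k}) x`, inverse `y ↦ (1 ⊗ t^k) y`**, over the constructed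
`B_max(F)`, for EVERY local framed `ρ : Γ_F → GL_m(ℚ̄_p)` and `k : ℕ`. [cite: FontaineAsterisque223III, Exp. III §1.5]
[cite: BuzzardGeeLMS2014, §2.4] -/
def DcrisTwistEquiv (ρ : FramedRep (absoluteGaloisGroup F) (PadicAlgCl p) m) (k : ℕ) :
    Dcris (F := F) (p := p) ρ ≃ₗ[PadicAlgCl p] Dcris (F := F) (p := p) (FramedRep.twist ρ (tateChar F p k)) :=
  twistEquiv (gal := galBmaxAlgHom (F := F) (p := p)) (coe_twist_tateChar ρ k)
    (fun σ => cycQp_pow_smul_galBmaxAlgHom_tInv_pow σ k) (coe_eq_smul_coe_twist_tateChar ρ k)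
    (fun σ => cycQp_inv_pow_smul_galBmaxAlgHom_tBmax_pow σ k) (tInv_pow_mul_algebraMap_tBmax_pow k)

/-- **Matrix form**: in the transported basis the matrix of `φ_{D_cris(ρ ⊗ χ^k)}^f` is `(p^{-k})^f ·` that of `φ_{D_cris(ρ)}^f`.
[cite: FontaineAsterisque223III, Exp. III §1.5] -/
theorem toMatrix_map_DcrisTwistEquiv_pow (ρ : FramedRep (absoluteGaloisGroup F) (PadicAlgCl p) m) (k : ℕ)
    {ι : Type*} [Fintype ι] [DecidableEq ι] (b : Module.Basis ι (PadicAlgCl p) (Dcris (F := F) (p := p) ρ)) (f : ℕ) :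
    LinearMap.toMatrix (b.map (DcrisTwistEquiv ρ k)) (b.map (DcrisTwistEquiv ρ k))
        (phiDcris (F := F) (p := p) (FramedRep.twist ρ (tateChar F p k)) ^ f) =
      algebraMap ℚ_[p] (PadicAlgCl p) ((p : ℚ_[p])⁻¹ ^ k) ^ f • LinearMap.toMatrix b b (phiDcris ρ ^ f) :=
  toMatrix_map_twistEquiv_pow (coe_twist_tateChar ρ k) (fun σ => cycQp_pow_smul_galBmaxAlgHom_tInv_pow σ k)
    (coe_eq_smul_coe_twist_tateChar ρ k) (fun σ => cycQp_inv_pow_smul_galBmaxAlgHom_tBmax_pow σ k)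
    (tInv_pow_mul_algebraMap_tBmax_pow k) galBmaxAlgHom_comp_frobBmaxAlgHom (frobBmaxAlgHom_tInv_pow k) b f

/-- `ι ((p^{-k})^f) = (p^{k f})⁻¹` in `ℂ` (`ι : ℚ̄_p ≃ ℂ` a ring isomorphism). [folklore] -/
theorem ringEquiv_algebraMap_inv_pow_pow (ι : PadicAlgCl p ≃+* ℂ) (k f : ℕ) :
    ι (algebraMap ℚ_[p] (PadicAlgCl p) ((p : ℚ_[p])⁻¹ ^ k) ^ f) = ((p : ℂ) ^ (k * f))⁻¹ := by
  simp only [map_pow, map_inv₀, map_natCast]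
  rw [← pow_mul, inv_pow]

/-- ★★ **Tate-twist transport of the clause's conclusion**: a basis of `D_cris(ρ)` indexed by `Fin N` with
`charpoly (φ^f) = geomFrobPolyOfSatake ι α ^ f` yields a basis of `D_cris(ρ₁)`, `ρ₁ = ρ ⊗ χ^k`, with
`charpoly (φ^f) = geomFrobPolyOfSatake ι (p^{-kf} · α) ^ f` (`ρ₁` tied by an equation, to transport along `toLocal_twist_tateChar`).
Every `ρ`, unconditionally. [cite: FontaineAsterisque223III, Exp. III §1.5] [cite: BuzzardGeeLMS2014, Conj. 3.2.2] -/
theorem exists_basis_charpoly_phiDcris_of_eq_twist (ρ ρ₁ : FramedRep (absoluteGaloisGroup F) (PadicAlgCl p) m)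
    (k : ℕ) (hρ₁ : ρ₁ = FramedRep.twist ρ (tateChar F p k)) (ι : PadicAlgCl p ≃+* ℂ) {α : Multiset ℂ} {N f : ℕ}
    (h : ∃ b : Module.Basis (Fin N) (PadicAlgCl p) (Dcris (F := F) (p := p) ρ),
      (LinearMap.toMatrix b b (phiDcris ρ ^ f)).charpoly = geomFrobPolyOfSatake ι α ^ f) :
    ∃ b : Module.Basis (Fin N) (PadicAlgCl p) (Dcris (F := F) (p := p) ρ₁), (LinearMap.toMatrix b b (phiDcris ρ₁ ^ f)).charpoly =
      geomFrobPolyOfSatake ι (α.map fun a => ((p : ℂ) ^ (k * f))⁻¹ * a) ^ f := by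
  subst hρ₁
  obtain ⟨b, hb⟩ := h
  refine ⟨b.map (DcrisTwistEquiv ρ k), ?_⟩
  rw [toMatrix_map_DcrisTwistEquiv_pow, ← ringEquiv_algebraMap_inv_pow_pow ι k f]
  exact charpoly_smul_eq_geomFrobPolyOfSatake_pow ι hb (pow_ne_zero _ ((_root_.map_ne_zero _).2
    (pow_ne_zero _ (inv_ne_zero (Nat.cast_ne_zero.2 (Fact.out : p.Prime).ne_zero)))))

end BmaxTwist

section Clause

variable {n : ℕ} {K : Type} [Field K] [NumberField K] {hcpt : isCompact_glFiniteIntegralLevel n K} {ℓ : ℕ} [Fact ℓ.Prime]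

/-- ★★★ **Tate-twist stability of `CrystallineCompatibleAt`**: if `(π, ρ)` satisfy the clause at `v ∣ ℓ`, `π` has
Satake parameter `α` at `v` and `π'` has parameter `q_v^{-k} · α` (`q_v = ℓ^{f(v|ℓ)}`), then `(π', ρ ⊗ χ_ℓ^k)` satisfy the
clause at `v` — instance for instance, every `ρ`, unconditionally (Satake parameters are unique: the tree's
`AutomorphicRepData.hasSatakeParamAt_unique_holds`). [cite: BuzzardGeeLMS2014, Conj. 3.2.2]
[cite: FontaineAsterisque223III, Exp. III §1.5] [cite: Flath1979, Thm. 3] -/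
theorem crystallineCompatibleAt_twist_tateChar (ι : PadicAlgCl ℓ ≃+* ℂ) (π π' : AutomorphicRepData (AutomorphyDatum.gl n K hcpt))
    (ρ : FramedGaloisRep K (PadicAlgCl ℓ) n) (v : HeightOneSpectrum (𝓞 K)) (hv : ((ℓ : ℕ) : 𝓞 K) ∈ v.asIdeal) (k : ℕ)
    {α : Multiset ℂ} (hπ : π.HasSatakeParamAt v α)
    (hπ' : π'.HasSatakeParamAt v (α.map fun a => ((ℓ : ℂ) ^ (k * v.asIdeal.inertiaDeg ℤ))⁻¹ * a))
    (h : CrystallineCompatibleAt ι π ρ v hv) : CrystallineCompatibleAt ι π' (FramedRep.twist ρ (tateChar K ℓ k)) v hv := by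
  unfold CrystallineCompatibleAt at h ⊢
  intro β hβ
  obtain rfl := AutomorphicRepData.hasSatakeParamAt_unique_holds π' hβ hπ'
  haveI := LocalField.charZero_adicCompletion v
  have hp := LocalField.valuation_adicCompletion_natCast_lt_one v ℓ hv
  haveI : Fact (¬ IsUnit ((ℓ : ℕ) : integerC (v.adicCompletion K))) := ⟨not_isUnit_natCast_integerC hp⟩
  haveI : IsAdicComplete (Ideal.span {((ℓ : ℕ) : integerC (v.adicCompletion K))}) (integerC (v.adicCompletion K)) :=
    isAdicComplete_integerC_natCast hp
  exact exists_basis_charpoly_phiDcris_of_eq_twist (ρ.toLocal v) _ k (toLocal_twist_tateChar ρ k v) ι (h α hπ)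

/-- ★★ **Every Tate twist `χ_ℓ^k · 𝟙_n` satisfies the clause at every absolutely unramified `v ∣ ℓ`**, against every
`π` with Satake parameter `{q_v^{-k}, …, q_v^{-k}}` at `v` — unconditionally, input-free (Λ12 transported along
`DcrisTwistEquiv`). [cite: BuzzardGeeLMS2014, Conj. 3.2.2] [cite: FontaineAsterisque223VIII, §2.3.7] -/
theorem crystallineCompatibleAt_twist_one_tateChar_of_ramificationIdx_eq_one (ι : PadicAlgCl ℓ ≃+* ℂ)
    (π : AutomorphicRepData (AutomorphyDatum.gl n K hcpt)) (v : HeightOneSpectrum (𝓞 K)) (hv : ((ℓ : ℕ) : 𝓞 K) ∈ v.asIdeal)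
    (he : v.asIdeal.ramificationIdx ℤ = 1) (k : ℕ)
    (hπ : π.HasSatakeParamAt v (Multiset.replicate n (((ℓ : ℂ) ^ (k * v.asIdeal.inertiaDeg ℤ))⁻¹))) :
    CrystallineCompatibleAt ι π (FramedRep.twist (1 : FramedGaloisRep K (PadicAlgCl ℓ) n) (tateChar K ℓ k)) v hv := by
  unfold CrystallineCompatibleAt
  intro β hβ
  obtain rfl := AutomorphicRepData.hasSatakeParamAt_unique_holds π hβ hπ
  haveI := LocalField.charZero_adicCompletion v
  have hp := LocalField.valuation_adicCompletion_natCast_lt_one v ℓ hv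
  haveI : Fact (¬ IsUnit ((ℓ : ℕ) : integerC (v.adicCompletion K))) := ⟨not_isUnit_natCast_integerC hp⟩
  haveI : IsAdicComplete (Ideal.span {((ℓ : ℕ) : integerC (v.adicCompletion K))}) (integerC (v.adicCompletion K)) :=
    isAdicComplete_integerC_natCast hp
  have h := exists_basis_charpoly_phiDcris_of_eq_twist ((1 : FramedGaloisRep K (PadicAlgCl ℓ) n).toLocal v) _ k
    (toLocal_twist_tateChar (1 : FramedGaloisRep K (PadicAlgCl ℓ) n) k v) ι (exists_basis_charpoly_phiDcris_toLocal_one ι v hv he)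
  rwa [Multiset.map_replicate, mul_one] at h

end Clause

end D2Cris

end Summit.Langlands.Langlands.Theorems

end
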